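import Summits.QuantumFields.YangMills.Theorems.BalabanUVNodesC44IterMhRegular
import Summits.QuantumFields.YangMills.Theorems.BalabanUVNodesProp4UniformAtRecord
import HarnessLib

/-!
# (ℓa-C) ROAD B, FILE F7 — PROP. 4 AT THE RECORD IN THE NODE-00 REGIME (`Ω_j = T`), REDUCED BY NAME TO (ℓa-H) + (ℓd) + `‖J‖`: the g6 door
# ✓`prop4UniformAtRecord_of_recordLetters_numeric` with (ℓa-C) filled from print's (14) (F6), (ℓa-num)∕(ℓb)∕(ℓc) already discharged there, and the weight
# profile `ω = Ω = 1` of the top level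

Cell `pub-ymgap` ∕ `ym-nodeO-ideate`, porter lineage `ymgap-nodeO-port-PTB-1` (gen 7), hand «(44) for `iterMh`» (director-ym g22 №569/№571; PORT-PLAN-v5 dc7ff9950b0ac185, sequel).
`--kind proof --supports stmt-QuantumFields-27238 --as helper`; count-neutral.  [B11] = [Balaban1985Variational]; [B8] = [Balaban1985RegularSpaces]; [I] = [Balaban1987RG1].

THE STATEMENT.  In the small-field approximation (every site in `Ω_k`) all level weights `(L^{j(b)}η_k)^p` are `1`, so `w̄ = w̲⁻¹ = 1` (✓`wSup_le_one_of_eq_one`, ✓`wInvSup_le_one_of_eq_one`,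
✓`levWeight_pairLevLit_eq_one`); (ℓa-C) is ✓`prop4LetterCAtRecord_of_regular` (F6) from print's regularity (14) at all scales `j < k`; (ℓa-num) ✓`prop4LetterNum_explicit`, (ℓb)
✓`prop4LetterV0AtRecord_of_window`, (ℓc) ✓`prop4LetterSymmAtRecord_holds` are the g6 discharges inside the door.  HENCE ★★★ `prop4UniformAtRecord_node00_of_HCol`: GIVEN (ℓa-H)
`Prop4LetterHAtRecord … b`, the (ℓd) columns `Prop4LetterColumnsAtRecord … r Gp R′ θ₃ θE θE′ N₁` at the explicit k-free radii `r, R′` below, `‖J‖ ≤ nJ`, print's (14) — small plaquettes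
of `Ū^j(U₀)` with the area law `α(L^jη_k)²` for `j < k` (tree `PlaqSmall`, the (0.4) tower) AND of `U₀` on lit's carrier (`‖U₀(∂p) − 1‖ ≤ αη_k²`, the `j = 0` clause in the (90)–(96)
vocabulary; the two plaquette conventions are not bridged in the tree, so both are displayed) — with ONE number `0 ≤ α ≤ (1.1·10⁷·N)⁻¹` — THEN `Prop4UniformAtRecord … r Gp C₄ R′` with
`C₂ = 1.28·10¹⁶·L·N`, `c₄ = (2·10¹¹·L·N)⁻¹`, `r = min(c₄∕4, ½, (16(bC₂+1))⁻¹)`, `R′ = min(r, (1 − 8bC₂r)∕16)`, `CV = (1024·N·(α + 1∕16) + 138·N)(d − 1)`, and `C₄` the door's polynomial —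
every constant a closed term in `L, N, b, α, θ₃, θE, θE′, N₁, nJ` («depend on d and L only» AS PROVENANCE given k-free (ℓa-H), (ℓd), nJ).

HONEST FRAMING.  Glue over F6 + the g6 door; no new estimate.  WHAT REMAINS for [B11] Prop. 4 at the record in this regime, BY NAME: (ℓa-H) (the (R1)-class propagator letter
(117)∕«Thm 3.13 of [5]»), (ℓd) (the four column bounds (86)–(89), (R1)-class), `‖J‖ ≤ nJ` (✓`Node00.norm_JOfRecordAtBg_le` under the (14) current window).  General `Ω`-profiles
need def-Y's family `C_j` (PORT-PLAN-v5 (F-β)).  (R1)∕(R2) OPEN; K0ᴬ ⟨stmt-QuantumFields-27238⟩ NOT closed; K0ᴬ∕K1ᴬ∕K3ᴬ 0∕3; NODE O 0∕1; COUNT 8∕28 · K 1∕4 UNMOVED; finite `𝕋⁴_{L^K}`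
at fixed ε — NOT continuum ∕ ℝ⁴ ∕ OS; **the Yang–Mills mass gap (Clay) is NOT proved by any of this.**  No `sorry`, `instance`, `notation`, `set_option`; standard axioms.
-/

noncomputable section

open scoped Matrix Matrix.Norms.L2Operator InnerProductSpace ComplexConjugate Topology NNReal

namespace Summit.QuantumFields.YangMills.Theorems.C44IterMh

open Literature.MathematicalPhysics.QuantumFieldTheory.Balaban1983to89
open Literature.MathematicalPhysics.QuantumFieldTheory.Balaban1983to89.Node00
open T4Continuum BlockAveraging
open B9Eq310DeltaPrime (plaqHolU)
open B11Eq103H1Complex (SiteL2K)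
open B11Eq115Space (NegSup levWeight levWeight_apply le_levOf)
open Summit.QuantumFields.YangMills.Theorems.Prop4UniformAtRecord (prop4UniformAtRecord_of_recordLetters_numeric)

/-! ## §1  Unit weights: `w̄ ≤ 1`, `w̲⁻¹ ≤ 1` -/

section Weights

variable {ι : Type*} [Fintype ι]

/-- If every weight is `1` then the largest weight is `≤ 1` (pointwise edition of ✓`UnitScaleTiltProp7SectET3WCurrentProp4RowsT3.wSup_const_le_one`, which is stated for
constant level maps). [cite: Balaban1985Variational, p.286 (bookkeeping)] -/
theorem wSup_le_one_of_eq_one (w : ι → ℝ) [Fact (∀ i, 0 < w i)] (hw : ∀ i, w i = 1) : (NegSup.wSup w : ℝ) ≤ 1 := by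
  have h1 : ∀ i, NegSup.wNN w i = 1 := fun i => by ext; rw [NegSup.coe_wNN, hw i, NNReal.coe_one]
  have h : NegSup.wSup w ≤ 1 := Finset.sup_le fun i _ => (h1 i).le
  exact_mod_cast h

/-- If every weight is `1` then the largest inverse weight is `≤ 1` (pointwise edition of ✓`…WCurrentProp4RowsT3.wInvSup_const_le_one`). [cite: Balaban1985Variational, p.286 (bookkeeping)] -/
theorem wInvSup_le_one_of_eq_one (w : ι → ℝ) [Fact (∀ i, 0 < w i)] (hw : ∀ i, w i = 1) : (NegSup.wInvSup w : ℝ) ≤ 1 := by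
  have h1 : ∀ i, NegSup.wNN w i = 1 := fun i => by ext; rw [NegSup.coe_wNN, hw i, NNReal.coe_one]
  have h : NegSup.wInvSup w ≤ 1 := Finset.sup_le fun i _ => by rw [h1 i, inv_one]
  exact_mod_cast h

end Weights

/-! ## §2  At the record: top-level pair weights, and the assembly -/

section Record

variable (F : T4Family) (N : ℕ) [NeZero N] (K k : ℕ) (Ω : ℕ → Set (Site (F.P K) 0)) (U₀ : GaugeField (F.P K) 0 (SU N))

omit [NeZero N] in
/-- **TOP-LEVEL PAIR WEIGHTS ARE `1`**: if every site lies in `Ω_k` then `j(a) = k` and `(L^{j(a)}η_k)² = 1`. [cite: Balaban1985Variational, p.286, (115) p.294] -/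
theorem levWeight_pairLevLit_eq_one [Fact (0 < (F.L : ℝ))] [Fact (0 < (F.P K).eta k)] (hΩ : ∀ x, x ∈ Ω k)
    (p : B9SectCLatticeCarrier.Bond (F.P K).d (fun _ => (F.P K).sitesPerDir 0) × Fin (F.P K).d) :
    levWeight (F.L : ℝ) ((F.P K).eta k) (pairLevLit F Ω k) 2 p = 1 := by
  have hlev : pairLevLit F Ω k p = k := le_antisymm (pairLevLit_le Ω k p) (le_levOf le_rfl (hΩ _))
  rw [levWeight_apply, hlev, L_pow_mul_eta_real, one_pow]

/-- ★★★ **[B11] PROP. 4 AT THE RECORD IN THE NODE-00 REGIME, REDUCED BY NAME TO (ℓa-H) + (ℓd) + `‖J‖`** — see the module docstring for the reading; (ℓa-C) from print's (14) by F6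
✓`prop4LetterCAtRecord_of_regular`, (ℓa-num)∕(ℓb)∕(ℓc) inside the g6 door ✓`prop4UniformAtRecord_of_recordLetters_numeric`, weights `ω = Ω = 1` at the top level.
[cite: Balaban1985Variational, Prop. 4 (97)–(98) pp.292–293, (14) p.280, (44)–(45) p.285, (86)–(89) p.291] -/
theorem prop4UniformAtRecord_node00_of_HCol [Fact (0 < (F.L : ℝ))] [Fact (0 < (F.P K).eta k)] [Fact (0 < c0Rec F K k)] [Fact (∀ c, 0 < wBRec F K k c)]
    (levB : PBond (F.P K) k → ℕ) (a : ℝ)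
    (hpos : ∀ x, x ≠ 0 → 0 < RCLike.re ⟪x, laplaceAOfRecord F N k U₀ (QOfRecord F N k U₀) (QflatOfRecord F N k) a x⟫_ℂ)
    (hQ : Function.Surjective (QOfRecord F N k U₀))
    (Gp : SiteL2K ℂ (F.P K).d (fun _ => (F.P K).sitesPerDir 0) (c0Rec F K k) (WRec N) →ₗ[ℂ]
      SiteL2K ℂ (F.P K).d (fun _ => (F.P K).sitesPerDir 0) (c0Rec F K k) (WRec N))
    {b α θ₃ θE θE' N₁ nJ : ℝ} (hb : 0 ≤ b) (hΩ : ∀ x, x ∈ Ω k) (hα0 : 0 ≤ α) (hα : α * (11000000 * N) ≤ 1)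
    (hreg : ∀ j, j < k → PlaqSmall (α * ((F.L : ℝ) ^ j * (F.P K).eta k) ^ 2) (Averaging.iter (avOfRecord F N K) j U₀))
    (hpl : ∀ p : B9SectCLatticeCarrier.Plaq (F.P K).d (fun _ => (F.P K).sitesPerDir 0),
      ‖(plaqHolU (unitsOfRecord F N U₀) p : Matrix (Fin N) (Fin N) ℂ) - 1‖ ≤ α * (F.P K).eta k ^ 2)
    (hH : Prop4LetterHAtRecord F N K k Ω U₀ levB a hpos hQ b)
    (hcol : letI C₂ : ℝ := 12800000000000000 * (F.L : ℝ) * N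
      letI c₄ : ℝ := 1 / (200000000000 * (F.L : ℝ) * N)
      letI r : ℝ := min (c₄ / 4) (min (1 / 2) (1 / (16 * (b * C₂ + 1))))
      Prop4LetterColumnsAtRecord F N K k Ω U₀ levB a hpos hQ r Gp (min r ((1 - 4 * b * C₂ * (r + r)) * (1 / 16))) θ₃ θE θE' N₁)
    (hJ : ‖JOfRecordAtBg F N K k Ω U₀‖ ≤ nJ) :
    letI C₂ : ℝ := 12800000000000000 * (F.L : ℝ) * N
    letI c₄ : ℝ := 1 / (200000000000 * (F.L : ℝ) * N)
    letI r : ℝ := min (c₄ / 4) (min (1 / 2) (1 / (16 * (b * C₂ + 1))))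
    letI R' : ℝ := min r ((1 - 4 * b * C₂ * (r + r)) * (1 / 16))
    letI CV : ℝ := 1024 * (((F.P K).d - 1 : ℕ) : ℝ) * ((1 : ℝ) * 1) ^ 3 * N * (α * (1 : ℝ) ^ 2 + 1 / 16)
        + (((F.P K).d - 1 : ℕ) : ℝ) * ((1 : ℝ) * 1) ^ 3 * (136 + 2 * ((1 : ℝ) * 1)) * N
    Prop4UniformAtRecord F N K k Ω U₀ levB a hpos hQ r Gp
      ((N * θ₃ * nJ + (N₁ * C₂ * (1 / (1 - 4 * b * C₂ * (r + r))) ^ 2 + N * θE')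
        + N * θE * (N₁ * C₂ * (1 / (1 - 4 * b * C₂ * (r + r))) ^ 2) * R'
        + N * (1 + θE * R') * CV * (1 / (1 - 4 * b * C₂ * (r + r))) ^ 2)) R' := by
  have hLN : (0 : ℝ) < (F.L : ℝ) * N := mul_pos Fact.out (by exact_mod_cast Nat.pos_of_ne_zero (NeZero.ne N))
  have hC₂ : (0 : ℝ) ≤ 12800000000000000 * (F.L : ℝ) * N := by rw [mul_assoc]; positivity
  have hc₄ : (0 : ℝ) < 1 / (200000000000 * (F.L : ℝ) * N) := by rw [mul_assoc]; positivity
  have hwb : ∀ i, levWeight (F.L : ℝ) ((F.P K).eta k) (bondLevLit F Ω k) 1 i = 1 := levWeight_bondLevLit_eq_one F k Ω hΩ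
  have hwp : ∀ p, levWeight (F.L : ℝ) ((F.P K).eta k) (pairLevLit F Ω k) 2 p = 1 := levWeight_pairLevLit_eq_one F K k Ω hΩ
  exact prop4UniformAtRecord_of_recordLetters_numeric F N K k Ω U₀ levB a hpos hQ Gp hb hC₂ hc₄ hH
    (prop4LetterCAtRecord_of_regular F N k Ω U₀ levB hΩ hα0 hα hreg) hα0 hpl le_rfl le_rfl (wSup_le_one_of_eq_one _ hwb)
    (wInvSup_le_one_of_eq_one _ hwb) (wInvSup_le_one_of_eq_one _ hwp) hcol hJ

/-- ★★★ **THE SAME AT PRINT'S (14) CURRENT WINDOW** — `‖J‖ ≤ C₁B₃ε₁` supplied by ✓`Node00.norm_JOfRecordAtBg_le` from the bondwise current clause `InU2cur … (C₁B₃ε₁)` of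
`U₀ ∈ 𝔘_k({Ω_j}, C₁B₃ε₁)`; the antecedent is now (ℓa-H) + (ℓd) + DOMAIN CLAUSES OF PRINT ((14): plaquettes at all scales `j < k`, plaquettes of `U₀` on lit's carrier, the current
window) and nothing else. [cite: Balaban1985Variational, Prop. 4 (97)–(98) pp.292–293, (14) p.280, (28) p.282] -/
theorem prop4UniformAtRecord_node00_of_HCol_window [Fact (0 < (F.L : ℝ))] [Fact (0 < (F.P K).eta k)] [Fact (0 < c0Rec F K k)] [Fact (∀ c, 0 < wBRec F K k c)]
    (levB : PBond (F.P K) k → ℕ) (a : ℝ)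
    (hpos : ∀ x, x ≠ 0 → 0 < RCLike.re ⟪x, laplaceAOfRecord F N k U₀ (QOfRecord F N k U₀) (QflatOfRecord F N k) a x⟫_ℂ)
    (hQ : Function.Surjective (QOfRecord F N k U₀))
    (Gp : SiteL2K ℂ (F.P K).d (fun _ => (F.P K).sitesPerDir 0) (c0Rec F K k) (WRec N) →ₗ[ℂ]
      SiteL2K ℂ (F.P K).d (fun _ => (F.P K).sitesPerDir 0) (c0Rec F K k) (WRec N))
    {b α θ₃ θE θE' N₁ C₁ B₃ ε₁ : ℝ} (hb : 0 ≤ b) (hΩ : ∀ x, x ∈ Ω k) (hα0 : 0 ≤ α) (hα : α * (11000000 * N) ≤ 1)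
    (hreg : ∀ j, j < k → PlaqSmall (α * ((F.L : ℝ) ^ j * (F.P K).eta k) ^ 2) (Averaging.iter (avOfRecord F N K) j U₀))
    (hpl : ∀ p : B9SectCLatticeCarrier.Plaq (F.P K).d (fun _ => (F.P K).sitesPerDir 0),
      ‖(plaqHolU (unitsOfRecord F N U₀) p : Matrix (Fin N) (Fin N) ℂ) - 1‖ ≤ α * (F.P K).eta k ^ 2)
    (hK : 0 ≤ C₁ * B₃ * ε₁) (h14 : B11Prop6Concrete.InU2cur (F.L : ℝ) ((F.P K).eta k) (bondLevLit F Ω k) (C₁ * B₃ * ε₁) (unitsOfRecord F N U₀))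
    (hH : Prop4LetterHAtRecord F N K k Ω U₀ levB a hpos hQ b)
    (hcol : letI C₂ : ℝ := 12800000000000000 * (F.L : ℝ) * N
      letI c₄ : ℝ := 1 / (200000000000 * (F.L : ℝ) * N)
      letI r : ℝ := min (c₄ / 4) (min (1 / 2) (1 / (16 * (b * C₂ + 1))))
      Prop4LetterColumnsAtRecord F N K k Ω U₀ levB a hpos hQ r Gp (min r ((1 - 4 * b * C₂ * (r + r)) * (1 / 16))) θ₃ θE θE' N₁) :
    letI C₂ : ℝ := 12800000000000000 * (F.L : ℝ) * N
    letI c₄ : ℝ := 1 / (200000000000 * (F.L : ℝ) * N)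
    letI r : ℝ := min (c₄ / 4) (min (1 / 2) (1 / (16 * (b * C₂ + 1))))
    letI R' : ℝ := min r ((1 - 4 * b * C₂ * (r + r)) * (1 / 16))
    letI CV : ℝ := 1024 * (((F.P K).d - 1 : ℕ) : ℝ) * ((1 : ℝ) * 1) ^ 3 * N * (α * (1 : ℝ) ^ 2 + 1 / 16)
        + (((F.P K).d - 1 : ℕ) : ℝ) * ((1 : ℝ) * 1) ^ 3 * (136 + 2 * ((1 : ℝ) * 1)) * N
    Prop4UniformAtRecord F N K k Ω U₀ levB a hpos hQ r Gp
      ((N * θ₃ * (C₁ * B₃ * ε₁) + (N₁ * C₂ * (1 / (1 - 4 * b * C₂ * (r + r))) ^ 2 + N * θE')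
        + N * θE * (N₁ * C₂ * (1 / (1 - 4 * b * C₂ * (r + r))) ^ 2) * R'
        + N * (1 + θE * R') * CV * (1 / (1 - 4 * b * C₂ * (r + r))) ^ 2)) R' :=
  prop4UniformAtRecord_node00_of_HCol F N K k Ω U₀ levB a hpos hQ Gp hb hΩ hα0 hα hreg hpl hH hcol
    (norm_JOfRecordAtBg_le (F := F) (N := N) (k := k) (Ω := Ω) (U₀ := U₀) hK h14)

end Record

end Summit.QuantumFields.YangMills.Theorems.C44IterMh

end
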